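import Mathlib
import Summits.NavierStokesRegularity.NavierStokesRegularity.Theorems.EulerZoomLiouvillePowerGaugeEulerLiouvilleWeakConfinedVorticityIntrinsic
import Literature.Analysis.FluidPDE.BiotSavartWeakLp
import Literature.Analysis.SingularIntegrals.HardyLittlewoodSobolev
import Literature.Analysis.FluidPDE.VorticityCalculus
import Literature.Analysis.FluidPDE.VectorCalculusProofs
import HarnessLib

/-!
# Crux `EulerZoomLiouville.PowerGaugeEulerLiouville` (stmt-NavierStokesRegularity-19832), weak stratum `stub_selfSimilarWeakRest`:
# TOOLS FOR THE INTEGRABLE-VORTICITY MEMBER — mollified vorticity in `L¹ ∩ L^{6/5}`, and the `L^{6/5} → L²` Hardy–Littlewood–Sobolev bound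
# for the Biot–Savart law

Route №10 `EulerZoomLiouville` (NavierStokesRegularity), crux E = stmt-NavierStokesRegularity-19832; width seat ns-ezl-w1 g8 under the LEAD
ns-typeII-p2 g14; sequel of `…WeakConfinedVorticity{Tools,,Intrinsic}` (p690361, p690763, p691156).  The confined-vorticity member is widened to
INTEGRABLE VORTICITY: profile vorticity `ω̃ = curlCLM ∘ G ∈ L¹(ℝ³) ∩ L^{6/5}(ℝ³)` (⊇ `L¹ ∩ L²`, ⊇ confined).  This file supplies the analysis:

* `symm_of_curlCLM_eq_zero` — a Jacobian with zero curl vector is symmetric (converse of `curlCLM_eq_zero_of_symm`);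
* `curl_mollify_eq_mollify_curlCLM` — `curl (φ ⋆ V) = φ ⋆ ω̃` everywhere; `norm_normed_convolution_le` — `‖(φ ⋆ g)(x)‖ ≤ M_φ ‖g‖₁`;
  `isWeaklyDivFree_curl_mollify` — `curl (φ ⋆ V)` is weakly divergence free (it is the classical curl of a smooth field);
* `lintegral_rpow_sixFifths_le` — `∫ ‖f‖^{6/5} ≤ ∫‖f‖ + ∫‖f‖²` (so `L¹ ∩ L² ⊆ L^{6/5}`), `memLp_sixFifths_of_integrable_of_memLp_two`;
* `lintegral_biotSavart_sq_le` — **`∫ ‖K₃ ∗ W‖² ≤ C (∫ ‖W‖^{6/5})^{5/3}`** from the tree's STRONG Hardy–Littlewood–Sobolev inequality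
  (`SingularIntegrals.lintegral_rieszPotential_rpow_le`, `p = 6/5`, `α = 1`, `q = 2`) and the pointwise domination
  `‖K₃ ∗ W‖ ≤ (4π)⁻¹ I₁‖W‖` (`enorm_biotSavart_le_rieszPotential`);
* `lintegral_rpow_sixFifths_mollify_le` — `∫‖φ ⋆ g‖^{6/5} ≤ ∫‖g‖^{6/5}` (Young with a unit-mass kernel, lintegral form).

WHAT THIS IS NOT: not NS, not E, not the weak stub — analysis tools `--supports` stmt-19832. [folklore; Stein1971 Ch. V §1.2 Thm 1; MajdaBertozziCUP2002
§2.4.1 (2.10)–(2.12); Evans2010 App. C.4 Thm. 7]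
-/

noncomputable section

-- flat `Theorems/<Route><Decl>…` files of one crux share the namespace of the crux (tree convention)
set_option linter.dupNamespace false

open MeasureTheory Set Filter Topology Metric Function TopologicalSpace ContinuousLinearMap
open scoped ENNReal NNReal Convolution InnerProductSpace RealInnerProductSpace ContDiff

namespace Summit.NavierStokesRegularity.NavierStokesRegularity.Theorems.PowerGaugeEulerLiouville.WeakConfinedVorticity

open Literature.Analysis Literature.Analysis.FunctionSpaces Literature.Analysis.FluidPDE Literature.Analysis.SingularIntegrals
open Summit.NavierStokesRegularity.NavierStokesRegularity.Theorems.PowerGaugeEulerLiouville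

/-! ### A Jacobian with zero curl is symmetric -/

/-- Components of the curl vector of a linear map on `ℝ³`. [folklore] -/
theorem curlCLM_apply_components (L : EuclideanSpace ℝ (Fin 3) →L[ℝ] EuclideanSpace ℝ (Fin 3)) :
    curlCLM L 0 = L (EuclideanSpace.single 1 1) 2 - L (EuclideanSpace.single 2 1) 1 ∧
      curlCLM L 1 = L (EuclideanSpace.single 2 1) 0 - L (EuclideanSpace.single 0 1) 2 ∧
        curlCLM L 2 = L (EuclideanSpace.single 0 1) 1 - L (EuclideanSpace.single 1 1) 0 := by
  change curlLM L 0 = _ ∧ curlLM L 1 = _ ∧ curlLM L 2 = _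
  simp only [curlLM, LinearMap.coe_mk, AddHom.coe_mk]
  refine ⟨?_, ?_, ?_⟩ <;> simp

/-- **A linear map on `ℝ³` with zero curl vector is symmetric** (converse of `curlCLM_eq_zero_of_symm`). [folklore] -/
theorem symm_of_curlCLM_eq_zero {L : EuclideanSpace ℝ (Fin 3) →L[ℝ] EuclideanSpace ℝ (Fin 3)} (h : curlCLM L = 0)
    (v w : EuclideanSpace ℝ (Fin 3)) : ⟪L v, w⟫ = ⟪L w, v⟫ := by
  obtain ⟨h0, h1, h2⟩ := curlCLM_apply_components L
  rw [h] at h0 h1 h2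
  have e0 : L (EuclideanSpace.single 1 1) 2 = L (EuclideanSpace.single 2 1) 1 := by
    have : (0 : EuclideanSpace ℝ (Fin 3)) 0 = 0 := rfl
    linarith [this.symm.trans h0]
  have e1 : L (EuclideanSpace.single 2 1) 0 = L (EuclideanSpace.single 0 1) 2 := by
    have : (0 : EuclideanSpace ℝ (Fin 3)) 1 = 0 := rfl
    linarith [this.symm.trans h1]
  have e2 : L (EuclideanSpace.single 0 1) 1 = L (EuclideanSpace.single 1 1) 0 := by
    have : (0 : EuclideanSpace ℝ (Fin 3)) 2 = 0 := rfl
    linarith [this.symm.trans h2]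
  refine symm_of_symm_basis (fun i j => ?_) v w
  rw [EuclideanSpace.inner_single_right, EuclideanSpace.inner_single_right]
  simp only [one_mul, conj_trivial]
  fin_cases i <;> fin_cases j <;> first | rfl | (simp only [Fin.zero_eta, Fin.mk_one, Fin.reduceFinMk] at * ; linarith)

/-! ### `L¹ ∩ L² ⊆ L^{6/5}` -/

/-- Pointwise: `t^{6/5} ≤ t + t²` on `[0,∞]`. [folklore] -/
theorem rpow_sixFifths_le (t : ℝ≥0∞) : t ^ (6 / 5 : ℝ) ≤ t + t ^ 2 := by
  rcases le_total t 1 with ht | ht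
  · calc t ^ (6 / 5 : ℝ) ≤ t ^ (1 : ℝ) := ENNReal.rpow_le_rpow_of_exponent_ge ht (by norm_num)
      _ = t := ENNReal.rpow_one t
      _ ≤ t + t ^ 2 := le_self_add
  · calc t ^ (6 / 5 : ℝ) ≤ t ^ (2 : ℝ) := ENNReal.rpow_le_rpow_of_exponent_le ht (by norm_num)
      _ = t ^ 2 := ENNReal.rpow_two t
      _ ≤ t + t ^ 2 := le_add_self

/-- `∫ ‖f‖^{6/5} ≤ ∫ ‖f‖ + ∫ ‖f‖²` for every a.e.-measurable `f`. [folklore] -/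
theorem lintegral_rpow_sixFifths_le {α F : Type*} [MeasurableSpace α] {μ : Measure α} [NormedAddCommGroup F]
    {f : α → F} (hf : AEStronglyMeasurable f μ) :
    ∫⁻ x, ‖f x‖ₑ ^ (6 / 5 : ℝ) ∂μ ≤ (∫⁻ x, ‖f x‖ₑ ∂μ) + ∫⁻ x, ‖f x‖ₑ ^ 2 ∂μ := by
  calc ∫⁻ x, ‖f x‖ₑ ^ (6 / 5 : ℝ) ∂μ ≤ ∫⁻ x, (‖f x‖ₑ + ‖f x‖ₑ ^ 2) ∂μ := lintegral_mono fun x => rpow_sixFifths_le _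
    _ = (∫⁻ x, ‖f x‖ₑ ∂μ) + ∫⁻ x, ‖f x‖ₑ ^ 2 ∂μ := lintegral_add_right' _ (hf.enorm.pow_const 2)

/-- **`L¹ ∩ L² ⊆ L^{6/5}`**: an integrable, square-integrable function has `∫‖f‖^{6/5} < ∞`. [folklore] -/
theorem lintegral_rpow_sixFifths_lt_top {α F : Type*} [MeasurableSpace α] {μ : Measure α} [NormedAddCommGroup F]
    {f : α → F} (h1 : Integrable f μ) (h2 : MemLp f 2 μ) :
    ∫⁻ x, ‖f x‖ₑ ^ (6 / 5 : ℝ) ∂μ < ⊤ := by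
  refine lt_of_le_of_lt (lintegral_rpow_sixFifths_le h1.aestronglyMeasurable) (ENNReal.add_lt_top.2 ⟨h1.2, ?_⟩)
  have := eLpNorm_nnreal_pow_eq_lintegral (f := f) (μ := μ) (p := (2 : ℝ≥0)) two_ne_zero
  rw [ENNReal.coe_ofNat] at this
  have h3 : ∫⁻ x, ‖f x‖ₑ ^ 2 ∂μ = eLpNorm f 2 μ ^ ((2 : ℝ≥0) : ℝ) := by
    rw [this]; refine lintegral_congr fun x => ?_; rw [NNReal.coe_ofNat, ENNReal.rpow_two]
  rw [h3, NNReal.coe_ofNat, ENNReal.rpow_two]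
  exact ENNReal.pow_lt_top h2.eLpNorm_lt_top

/-! ### The `L^{6/5} → L²` Hardy–Littlewood–Sobolev bound for the Biot–Savart law -/

/-- **`∫ ‖K₃ ∗ W‖² ≤ C (∫ ‖W‖^{6/5})^{5/3}`** for every a.e.-strongly measurable `W : ℝ³ → ℝ³`, with a universal finite `C`: the strong
Hardy–Littlewood–Sobolev inequality for the Riesz potential `I₁` at `p = 6/5` (`q = 3p/(3−p) = 2`) and `‖K₃ ∗ W‖ ≤ (4π)⁻¹ I₁‖W‖`.
[cite: Stein1971, Ch. V §1.2 Theorem 1 (b); MajdaBertozziCUP2002 §2.4.1 (2.10)–(2.12)] -/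
theorem lintegral_biotSavart_sq_le :
    ∃ C : ℝ≥0∞, C < ⊤ ∧ ∀ W : EuclideanSpace ℝ (Fin 3) → EuclideanSpace ℝ (Fin 3), AEStronglyMeasurable W volume →
      ∫⁻ x, ‖biotSavart W x‖ₑ ^ 2 ≤ C * (∫⁻ y, ‖W y‖ₑ ^ (6 / 5 : ℝ)) ^ (5 / 3 : ℝ) := by
  have h3 : (Module.finrank ℝ (EuclideanSpace ℝ (Fin 3)) : ℝ) = 3 := by
    rw [finrank_euclideanSpace_fin]; norm_num
  obtain ⟨C, hC, H⟩ := lintegral_rieszPotential_rpow_le (volume : Measure (EuclideanSpace ℝ (Fin 3)))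
    (p := 6 / 5) (α := 1) (by norm_num) one_pos (by rw [h3]; norm_num)
  rw [h3] at H
  have e1 : (3 : ℝ) * (6 / 5) / (3 - 1 * (6 / 5)) = 2 := by norm_num
  have e2 : (3 : ℝ) / (3 - 1 * (6 / 5)) = 5 / 3 := by norm_num
  rw [e1, e2] at H
  refine ⟨ENNReal.ofReal (4 * Real.pi)⁻¹ ^ 2 * C, ENNReal.mul_lt_top (ENNReal.pow_lt_top ENNReal.ofReal_lt_top) hC,
    fun W hW => ?_⟩
  have hpt : ∀ x, ‖biotSavart W x‖ₑ ^ 2 ≤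
      ENNReal.ofReal (4 * Real.pi)⁻¹ ^ 2 * rieszPotential volume 1 (fun y => (‖W y‖ₑ : ℝ≥0∞)) x ^ (2 : ℝ) := by
    intro x
    have h := enorm_biotSavart_le_rieszPotential W x
    calc ‖biotSavart W x‖ₑ ^ 2 ≤ (ENNReal.ofReal (4 * Real.pi)⁻¹ * rieszPotential volume 1 (fun y => (‖W y‖ₑ : ℝ≥0∞)) x) ^ 2 :=
          pow_le_pow_left' h 2
      _ = _ := by rw [mul_pow, ENNReal.rpow_two]
  calc ∫⁻ x, ‖biotSavart W x‖ₑ ^ 2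
      ≤ ∫⁻ x, ENNReal.ofReal (4 * Real.pi)⁻¹ ^ 2 * rieszPotential volume 1 (fun y => (‖W y‖ₑ : ℝ≥0∞)) x ^ (2 : ℝ) :=
        lintegral_mono hpt
    _ = ENNReal.ofReal (4 * Real.pi)⁻¹ ^ 2 * ∫⁻ x, rieszPotential volume 1 (fun y => (‖W y‖ₑ : ℝ≥0∞)) x ^ (2 : ℝ) := by
        rw [lintegral_const_mul' _ _ (ENNReal.pow_ne_top ENNReal.ofReal_ne_top)]
    _ ≤ ENNReal.ofReal (4 * Real.pi)⁻¹ ^ 2 * (C * (∫⁻ y, ‖W y‖ₑ ^ (6 / 5 : ℝ)) ^ (5 / 3 : ℝ)) :=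
        mul_le_mul' le_rfl (H _ hW.enorm)
    _ = _ := by rw [mul_assoc]

/-! ### Mollified vorticity -/

section Mollify

variable {V : EuclideanSpace ℝ (Fin 3) → EuclideanSpace ℝ (Fin 3)}
  {G : EuclideanSpace ℝ (Fin 3) → EuclideanSpace ℝ (Fin 3) →L[ℝ] EuclideanSpace ℝ (Fin 3)}

/-- **The curl of the mollification is the mollified vorticity**, everywhere: `curl (φ ⋆ V) = φ ⋆ (curlCLM ∘ G)`. [folklore; Evans2010 §5.3.1 Thm. 1] -/
theorem curl_mollify_eq_mollify_curlCLM (hw : HasWeakFDerivOn (⊤ : Opens (EuclideanSpace ℝ (Fin 3))) volume V G)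
    (φ : ContDiffBump (0 : EuclideanSpace ℝ (Fin 3))) :
    curl (φ.normed volume ⋆[lsmul ℝ ℝ, volume] V) = φ.normed volume ⋆[lsmul ℝ ℝ, volume] (fun y => curlCLM (G y)) := by
  funext x
  rw [curl_eq_curlCLM, clm_fderiv_mollify_eq_integral hw φ curlCLM x, normed_convolution_apply]

/-- **Mollifications of an integrable function are bounded**: `‖(φ ⋆ g)(x)‖ ≤ M_φ ∫‖g‖` with `M_φ = sup |φ.normed|`. [folklore] -/
theorem exists_bound_normed_convolution {F : Type*} [NormedAddCommGroup F] [NormedSpace ℝ F] [CompleteSpace F]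
    (φ : ContDiffBump (0 : EuclideanSpace ℝ (Fin 3))) {g : EuclideanSpace ℝ (Fin 3) → F} (hg : Integrable g volume) :
    ∃ M : ℝ, ∀ x, ‖(φ.normed volume ⋆[lsmul ℝ ℝ, volume] g) x‖ ≤ M := by
  obtain ⟨M, hM⟩ := φ.continuous_normed.bounded_above_of_compact_support (φ.hasCompactSupport_normed (μ := volume))
  refine ⟨M * ∫ y, ‖g y‖, fun x => ?_⟩
  rw [normed_convolution_apply]
  have hint : Integrable (fun t => M * ‖g (x - t)‖) volume := ((hg.comp_sub_left x).norm.const_mul M)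
  calc ‖∫ t, φ.normed volume t • g (x - t)‖ ≤ ∫ t, M * ‖g (x - t)‖ := by
        refine norm_integral_le_of_norm_le hint (Eventually.of_forall fun t => ?_)
        rw [norm_smul]
        exact mul_le_mul_of_nonneg_right (hM t) (norm_nonneg _)
    _ = M * ∫ y, ‖g y‖ := by
        rw [integral_const_mul, integral_sub_left_eq_self (fun t => ‖g t‖) volume x]

/-- **`∫‖φ ⋆ g‖^{6/5} ≤ ∫‖g‖^{6/5}`** (Young's inequality with a unit-mass kernel, in `∫⁻`-form). [folklore; Evans2010 App. C.4 Thm. 7] -/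
theorem lintegral_rpow_sixFifths_mollify_le {F : Type*} [NormedAddCommGroup F] [NormedSpace ℝ F] [CompleteSpace F]
    (φ : ContDiffBump (0 : EuclideanSpace ℝ (Fin 3))) {g : EuclideanSpace ℝ (Fin 3) → F} (hg : AEStronglyMeasurable g volume) :
    ∫⁻ x, ‖(φ.normed volume ⋆[lsmul ℝ ℝ, volume] g) x‖ₑ ^ (6 / 5 : ℝ) ≤ ∫⁻ x, ‖g x‖ₑ ^ (6 / 5 : ℝ) := by
  have hp1 : (1 : ℝ≥0∞) ≤ ENNReal.ofReal (6 / 5) := by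
    rw [← ENNReal.ofReal_one]; exact ENNReal.ofReal_le_ofReal (by norm_num)
  have hY := eLpNorm_normed_convolution_le φ (h := g) hg (p := ENNReal.ofReal (6 / 5)) hp1
  have hp0 : ENNReal.ofReal (6 / 5) ≠ 0 := (lt_of_lt_of_le one_pos hp1).ne'
  have hpt : (ENNReal.ofReal (6 / 5)).toReal = 6 / 5 := ENNReal.toReal_ofReal (by norm_num)
  rw [eLpNorm_eq_lintegral_rpow_enorm_toReal hp0 ENNReal.ofReal_ne_top, eLpNorm_eq_lintegral_rpow_enorm_toReal hp0 ENNReal.ofReal_ne_top,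
    hpt] at hY
  have h56 : (0 : ℝ) < 1 / (6 / 5) := by norm_num
  exact (ENNReal.rpow_le_rpow_iff h56).1 hY

/-- **The mollified vorticity is weakly divergence free** (it is the classical curl of the smooth field `φ ⋆ V`, and `div curl = 0`). [folklore] -/
theorem isWeaklyDivFree_curl_mollify (hw : HasWeakFDerivOn (⊤ : Opens (EuclideanSpace ℝ (Fin 3))) volume V G)
    (φ : ContDiffBump (0 : EuclideanSpace ℝ (Fin 3))) :
    IsWeaklyDivFree (curl (φ.normed volume ⋆[lsmul ℝ ℝ, volume] V)) := by
  have hV := contDiff_mollify hw φ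
  have hV2 : ContDiff ℝ 2 (φ.normed volume ⋆[lsmul ℝ ℝ, volume] V) := hV.of_le (by norm_cast)
  have hW1 : ContDiff ℝ 1 (curl (φ.normed volume ⋆[lsmul ℝ ℝ, volume] V)) := by
    rw [curl_eq_curlCLM_comp]
    exact curlCLM.contDiff.comp (hV.fderiv_right (m := 1) (by norm_cast))
  exact VectorCalculus.IsDivFree.isWeaklyDivFree_holds (fun x => divergence_curl_eq_zero_holds _ hV2 x) hW1

/-- The mollified vorticity is `C¹` (indeed smooth). [folklore] -/
theorem contDiff_one_curl_mollify (hw : HasWeakFDerivOn (⊤ : Opens (EuclideanSpace ℝ (Fin 3))) volume V G)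
    (φ : ContDiffBump (0 : EuclideanSpace ℝ (Fin 3))) :
    ContDiff ℝ 1 (curl (φ.normed volume ⋆[lsmul ℝ ℝ, volume] V)) := by
  rw [curl_eq_curlCLM_comp]
  exact curlCLM.contDiff.comp ((contDiff_mollify hw φ).fderiv_right (m := 1) (by norm_cast))

/-- With integrable vorticity `curlCLM ∘ G ∈ L¹`, the mollified vorticity is integrable, bounded and continuous. [folklore] -/
theorem curl_mollify_integrable_bounded (hw : HasWeakFDerivOn (⊤ : Opens (EuclideanSpace ℝ (Fin 3))) volume V G)
    (hω1 : Integrable (fun y => curlCLM (G y)) volume) (φ : ContDiffBump (0 : EuclideanSpace ℝ (Fin 3))) :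
    Integrable (curl (φ.normed volume ⋆[lsmul ℝ ℝ, volume] V)) volume ∧
      (∃ M : ℝ, ∀ x, ‖curl (φ.normed volume ⋆[lsmul ℝ ℝ, volume] V) x‖ ≤ M) ∧
        Continuous (curl (φ.normed volume ⋆[lsmul ℝ ℝ, volume] V)) := by
  refine ⟨?_, ?_, (contDiff_one_curl_mollify hw φ).continuous⟩
  · rw [curl_mollify_eq_mollify_curlCLM hw φ]
    exact (φ.integrable_normed (μ := volume)).integrable_convolution (lsmul ℝ ℝ) hω1
  · rw [curl_mollify_eq_mollify_curlCLM hw φ]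
    exact exists_bound_normed_convolution φ hω1

end Mollify

end Summit.NavierStokesRegularity.NavierStokesRegularity.Theorems.PowerGaugeEulerLiouville.WeakConfinedVorticity

end
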